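import Summits.QuantumFields.BalabanUV.Beta.FP.PerfectBubbleSandwich
import Summits.QuantumFields.BalabanUV.Beta.FP.RepAlgebraBubble

/-!
# `BalabanUV.Beta.FP.PerfectKernelSymm` — road «FP» for binder row D1: THE TRANSPOSITION (HESSIAN) SYMMETRY OF THE ONE-STEP POLARIZATION KERNEL
# `hessKer A V W a b t = hessKer A V W b a (−t)` — the supplier SHAPE of the socket `hTsymm` of `FP/StepLawWard(Rows)` (owner ruling R-FP-9):
# from coarse-translation invariance of the leg, coarse covariance of the vertex families, SYMMETRY of the second-order table, and the cyclic
# trace (`bubble_comm`); instantiated at `TPerfOf n K S W`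

HONEST DEPENDENCY (page 1, mandatory): continuum YM on T⁴ ⇐ BetaPertH ∧ nine spine estimates (0/9 proved); BetaPertH ⇐ (D1) ∧ (D4) ∧
CAP+tail; G-an2-4 gates asym, D1 and NE2/3/4.  HONEST FRAMING (cell contract, verbatim): «discharging `BetaPertH` makes Bałaban's UV
stability UNCONDITIONAL — a real constructive-QFT result; it is NOT the continuum limit and NOT the Clay problem.»  THIS MODULE DISCHARGES
NOTHING of D1 / BetaPertH: [folklore] kernel algebra BY NAME (`ExpKernelCalculus.tadpole_shiftK` ∕ `bubble_shiftK`, the owner d1-p3's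
`RepAlgebraBubble.bubble_comm`, an2's `AxialDressing` ∕ `BalabanStepJetsSucc.vertexOfK_translate_block`, gen 3's `PerfectBubbleSandwich.legAx₁_shiftK` ∕
`PerfectBubbleExpansion.axVertexOfK_eq_vertexOfK_legAx₁`).  The covariance ∕ symmetry of the stencils and tables are DISPLAYED hypotheses.  No `def`, no
cited fact, 0 sorry; NOT D1, NOT BetaPertH, NOT continuum, NOT Clay.

ABSOLUTE RULE (cell charter, verbatim): «No internally-minted statement may enter as a cited fact. Every hypothesis is either
kernel-proved in this package or a verbatim quotation of a PUBLISHED theorem with page reference. The manuscript(s) under audit are NOT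
citable for their own disputed steps — they are the thing under adjudication; programme-internal (2001/route/tribunal) claims are never
citable.»

WHY.  `FP/StepLawWardRows` (gen 4) removed an2's hR row from road FP's END in favour of the socket
`hTsymm : TPerfOf Lc (KPerf …1) (SPerfOf … S 1) (WPerfOf … Wt 1) a b t = (same) b a (−t)`.  This module proves that shape for `TPerfOf n K S W` from:
coarse invariance of `K` (`shiftK (−n•t) K = K` — `SymmetryK.shiftK_KPerf` on the road), coarse covariance of `S` (`PerfectJetsTranslate.SPerfOf_one_translate`),
coarse covariance of `W` (`WPerfOf_one_translate`) and SYMMETRY of `W` under the swap of its two coarse bonds (the limit of the wall tables' symmetry) —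
so the only NEW datum behind `hTsymm` is the table symmetry `W μ y ν y′ = W ν y′ μ y`.

CONTENT: `shiftK_shiftK_neg` ([folklore]); **`hessKer_swap`** ([folklore], any dimension ∕ fibre: leg coarse-invariant and decaying, first-order family
coarse-covariant and localised, second-order family coarse-covariant and symmetric); `legAx₁_blockCov`; **`TPerfOf_swap`** ([our object]: the road's literal).
Unit `b2b-balaban-beta-d1-formalise-leaf-02` (gen 4).
-/

noncomputable section

namespace Summit.QuantumFields.BalabanUV.Beta.FP.PerfectKernelSymm

open Literature.MathematicalPhysics.QuantumFieldTheory.Balaban1983to89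
open Literature.MathematicalPhysics.QuantumFieldTheory.Balaban1983to89.Beta
open ExpKernelCalculus (Site MKer Decays BiLoc VertexFamily tadpole bubble hessKer shiftK tadpole_shiftK bubble_shiftK)
open OneStepResolventKernel (Fib LocStencil)
open OneStepKernelFamily (vertexOfK)
open AxialDressing (legAx₁ axDressK axVertexOfK decays_axDressK vertexFamily_axVertexOfK')
open BalabanStepJetsSucc (vertexOfK_translate_block)
open Summit.QuantumFields.BalabanUV.Beta.TameKernelCalculus
open Summit.QuantumFields.BalabanUV.Beta.FP.PerfectObjectsT (TPerfOf)
open Summit.QuantumFields.BalabanUV.Beta.FP.RepAlgebraBubble (bubble_comm)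
open Summit.QuantumFields.BalabanUV.Beta.FP.PerfectBubbleExpansion (axVertexOfK_eq_vertexOfK_legAx₁)
open Summit.QuantumFields.BalabanUV.Beta.FP.PerfectBubbleSandwich (legAx₁_shiftK axDressK_blockCov)

/-! ## §1 Generic: the Hessian kernel is symmetric under `(a, t) ↔ (b, −t)` -/

section Generic

variable {D : ℕ} {F : Type*} [Fintype F]

omit [Fintype F] in
/-- [folklore] Shifting back and forth is the identity. -/
theorem shiftK_shiftK_neg (v : Site D) (K : MKer D F) : shiftK v (shiftK (-v) K) = K := by
  funext x y a b
  simp only [shiftK, add_neg_cancel_right]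

/-- [folklore] **TRANSPOSITION SYMMETRY OF THE HESSIAN KERNEL.**  Leg `A` decaying and invariant under coarse translations `n•t`; first-order vertex
family `V` localised at its coarse bond (`VertexFamily V n`) and coarse-covariant; second-order family `W` coarse-covariant and SYMMETRIC under the swap
of its two coarse bonds: `hessKer A V W a b t = hessKer A V W b a (−t)` — the tadpole by table symmetry + covariance + `tadpole_shiftK`, the bubble by
the cyclic trace (`bubble_comm`) + covariance + `bubble_shiftK`. -/
theorem hessKer_swap {A : MKer D F} {C δ : ℝ} (hA : Decays A C δ) (hδ : 0 < δ) {n : ℕ}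
    (hAcov : ∀ t : Site D, shiftK (-((n : ℤ) • t)) A = A)
    {V : Fin D → Site D → MKer D F} {Cv : ℝ} (hV : VertexFamily V n Cv δ)
    (hVcov : ∀ (μ : Fin D) (y t : Site D), V μ (y + t) = shiftK (-((n : ℤ) • t)) (V μ y))
    {W : Fin D → Site D → Fin D → Site D → MKer D F}
    (hWcov : ∀ (μ : Fin D) (y : Site D) (ν : Fin D) (y' t : Site D), W μ (y + t) ν (y' + t) = shiftK (-((n : ℤ) • t)) (W μ y ν y'))
    (hWsymm : ∀ (μ : Fin D) (y : Site D) (ν : Fin D) (y' : Site D), W μ y ν y' = W ν y' μ y)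
    (a b : Fin D) (t : Site D) :
    hessKer A V W a b t = hessKer A V W b a (-t) := by
  have hAcov' : shiftK ((n : ℤ) • t) A = A := by
    have h := hAcov (-t)
    rwa [smul_neg, neg_neg] at h
  -- the second-order table: swap, then translate by `t`
  have hW' : W b 0 a (-t) = shiftK ((n : ℤ) • t) (W a 0 b t) := by
    rw [hWsymm b 0 a (-t)]
    have h := hWcov a (-t) b 0 t
    rw [neg_add_cancel, zero_add] at h
    rw [h, shiftK_shiftK_neg]
  -- the first-order vertices, translated by `t`
  have hV1 : V a (-t) = shiftK ((n : ℤ) • t) (V a 0) := by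
    have h := hVcov a (-t) t
    rw [neg_add_cancel] at h
    rw [h, shiftK_shiftK_neg]
  have hV2 : V b 0 = shiftK ((n : ℤ) • t) (V b t) := by
    have h := hVcov b 0 t
    rw [zero_add] at h
    rw [h, shiftK_shiftK_neg]
  have htad : tadpole A (W b 0 a (-t)) = tadpole A (W a 0 b t) := by
    rw [hW']
    conv_lhs => rw [← hAcov']
    exact tadpole_shiftK _ _ _
  have hbub : bubble A (V b 0) (V a (-t)) = bubble A (V a 0) (V b t) := by
    rw [bubble_comm hA hδ (hV b 0) (hV a (-t)), hV1, hV2]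
    conv_lhs => rw [← hAcov']
    exact bubble_shiftK _ _ _ _
  show (1 / 2 : ℝ) * tadpole A (W a 0 b t) - (1 / 2 : ℝ) * bubble A (V a 0) (V b t)
    = (1 / 2 : ℝ) * tadpole A (W b 0 a (-t)) - (1 / 2 : ℝ) * bubble A (V b 0) (V a (-t))
  rw [htad, hbub]

end Generic

/-! ## §2 The road's literal `TPerfOf n K S W` -/

section Perfect

variable {d : ℕ}

/-- [folklore] `legAx₁ N K` inherits coarse-translation invariance from `K` (`PerfectBubbleSandwich.legAx₁_shiftK`). -/
theorem legAx₁_blockCov {N : ℕ} (hN : 1 ≤ N) {K : MKer (d + 1) (Fib d)} (hKcov : ∀ t : Fin (d + 1) → ℤ, shiftK (-((N : ℤ) • t)) K = K)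
    (t : Fin (d + 1) → ℤ) : shiftK (-((N : ℤ) • t)) (legAx₁ N K) = legAx₁ N K := by
  have h := legAx₁_shiftK hN K (-t)
  rw [smul_neg] at h
  rw [← h, hKcov t]

/-- [our object] **TRANSPOSITION SYMMETRY OF THE ONE-STEP POLARIZATION KERNEL `TPerfOf n K S W`** (`1 ≤ n`): decaying coarse-invariant `K`, local
coarse-covariant stencil family `S`, coarse-covariant second-order family `W` SYMMETRIC under the swap of its two coarse bonds ⟹
`TPerfOf n K S W a b t = TPerfOf n K S W b a (−t)` — the shape of the socket `hTsymm` of `StepLawWardRows` (at `K := KPerf …1`, `S := SPerfOf … S 1`,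
`W := WPerfOf … Wt 1`: `SymmetryK.shiftK_KPerf`, `PerfectJetsTranslate.SPerfOf_one_translate` ∕ `WPerfOf_one_translate`, and the limit of the wall tables'
symmetry supply the three covariance ∕ symmetry inputs). -/
theorem TPerfOf_swap {n : ℕ} (hn : 1 ≤ n) {K : MKer (3 + 1) (Fib 3)} {C δK : ℝ} (hK : Decays K C δK) (hδK : 0 < δK)
    (hKcov : ∀ t : Fin (3 + 1) → ℤ, shiftK (-((n : ℤ) • t)) K = K)
    {S : Fin (3 + 1) → (Fin (3 + 1) → ℤ) → MKer (3 + 1) (Fib 3)} {Cs δs : ℝ} (hS : LocStencil S Cs δs) (hδs : 0 < δs)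
    (hScov : ∀ (κ : Fin (3 + 1)) (u t : Fin (3 + 1) → ℤ), S κ (u + (n : ℤ) • t) = shiftK (-((n : ℤ) • t)) (S κ u))
    {W : Fin (3 + 1) → (Fin (3 + 1) → ℤ) → Fin (3 + 1) → (Fin (3 + 1) → ℤ) → MKer (3 + 1) (Fib 3)}
    (hWcov : ∀ (μ : Fin (3 + 1)) (y : Fin (3 + 1) → ℤ) (ν : Fin (3 + 1)) (y' t : Fin (3 + 1) → ℤ),
      W μ (y + t) ν (y' + t) = shiftK (-((n : ℤ) • t)) (W μ y ν y'))
    (hWsymm : ∀ (μ : Fin (3 + 1)) (y : Fin (3 + 1) → ℤ) (ν : Fin (3 + 1)) (y' : Fin (3 + 1) → ℤ), W μ y ν y' = W ν y' μ y)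
    (a b : Fin (3 + 1)) (t : Fin (3 + 1) → ℤ) :
    TPerfOf n K S W a b t = TPerfOf n K S W b a (-t) := by
  haveI : NeZero n := ⟨by omega⟩
  -- localisation of the dressed vertex family and decay of the dressed leg, at one common rate
  obtain ⟨Cv, δv, hδv, hV⟩ := vertexFamily_axVertexOfK' (N := n) ⟨δK, C, hδK, hK.nonneg (Sum.inl 0), hK⟩ hS hδs
  have hm : 0 < min δK δv := lt_min hδK hδv
  have hA := decays_of_le (decays_axDressK hn hK hδK.le) (min_le_left δK δv)
  have hV' : VertexFamily (axVertexOfK K n S) n (|Cv|) (min δK δv) := fun μ y => biLoc_of_le (hV μ y) (min_le_right _ _)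
  -- coarse covariance of the dressed vertex family (`axVertexOfK = vertexOfK (legAx₁ n K) n S`)
  have hVcov : ∀ (μ : Fin (3 + 1)) (y s : Fin (3 + 1) → ℤ), axVertexOfK K n S μ (y + s) = shiftK (-((n : ℤ) • s)) (axVertexOfK K n S μ y) := by
    intro μ y s
    rw [axVertexOfK_eq_vertexOfK_legAx₁]
    exact vertexOfK_translate_block (legAx₁_blockCov hn hKcov) hScov μ y s
  exact hessKer_swap hA hm (axDressK_blockCov hn hKcov) hV' hVcov hWcov hWsymm a b t

end Perfect

end Summit.QuantumFields.BalabanUV.Beta.FP.PerfectKernelSymm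

end
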